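import Summits.NavierStokesRegularity.NavierStokesRegularity.Theorems.FilamentSkeletonRssSkeletonJ1RLiaPartnerReference
import Summits.NavierStokesRegularity.NavierStokesRegularity.Theorems.FilamentSkeletonRssSkeletonJ1RLiaFootGeometry
import Summits.NavierStokesRegularity.NavierStokesRegularity.Theorems.FilamentSkeletonRssSkeletonJ1RLiaDefectSelfArith

/-!
# Route `FilamentSkeletonRss` · crux `SkeletonJ1R` (stmt-NavierStokesRegularity-23610) · stub F2 `LiaDefectL` — Γ-BOOKKEEPING BRICK (B2):
# each partner term of the defect of the LIA reference is `O((√Γ + |τ|)/√log Γ)` (RATE B), constants uniform in the datum class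

Lead `ns-fsr-lead-23610` (g2), line `streamline_kantorovich_R` (skeleton of record v5).  Helper file `--supports stmt-NavierStokesRegularity-23610`;
route-independent (no `Theses` import).

`partnerTerm_bound`: given the datum CLASS constants (`N`, `θp` with `θp ≤ |γ_k|`, `|γ_k|, |α| ≤ θp⁻¹`, general position `θg ∈ (0,1]`, separation
`ρd`, waist radius `Rwd ≥ ‖q_k‖`, tolerance `0 < Rb ≤ 4/5` with the geometric smallness `Rb ≤ 4c⋆/(5C⋆)`) there are `Cpart, Lmin` such that for
every `Γ > 1` with `log Γ ≥ Lmin`, every such datum, THE local-induction reference `x` with tilt `≤ Rb/8` (inside the partner-distance budget `θ₁`),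
every pair `k ≠ j` and every `|τ| ≤ 3Rb√Γ√log Γ`:
`‖(Γγ_k/4π) • (S_k[x_k](x_j τ) − S_k[L_k](x_j τ))‖ ≤ Cpart · (√Γ + |τ|)/√(log Γ)`.
This is brick P2 (`IsLiaReference.partnerStrand_sub_le`) at `y = x_j τ` with the foot geometry of brick G (`a ≥ c⋆(√Γ + |τ|)`,
`|s| ≤ C⋆(√Γ + |τ|)`, `c⋆ = min (ρd/4) (3ρd√θg/(16(2Rwd + ρd/2)))`, `C⋆ = 2Rwd + 1`), `L₀ = 4ℓ`, and the partner's linear curvature envelope (brick E2).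
HONEST FRAMING: MODEL rung, ∃-side helper lemmas toward stub F2 of a HYPOTHETICAL filament-type blow-up skeleton; F2 and the crux 23610 stay OPEN;
nothing here bears on Navier–Stokes regularity, which is NOT proved. [folklore]
-/

-- `dupNamespace` off: the module name repeats `NavierStokesRegularity` by the tree's `Summits/<S>/<S>/Theorems` layout (same as every sibling file).
set_option linter.dupNamespace false
-- `unusedTactic`/`unreachableTactic` off: the `first | (field_simp; ring) | field_simp` closers below are robust to how far `field_simp` normalises.
set_option linter.unusedTactic false
set_option linter.unreachableTactic false

noncomputable section

namespace Summit.NavierStokesRegularity.NavierStokesRegularity.Theorems.SkeletonJ1RFrame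

open Set Function Filter Real Topology MeasureTheory
open Literature.Analysis.FluidPDE
open scoped InnerProductSpace BigOperators

set_option maxHeartbeats 1600000 in
/-- **Each partner term is `O((√Γ + |τ|)/√log Γ)`** (see the module docstring). [folklore] -/
theorem partnerTerm_bound (N : ℕ) {θp θg ρd Rwd Rb : ℝ} (hθp : 0 < θp) (hθg : 0 < θg) (hθg1 : θg ≤ 1) (hρ : 0 < ρd) (hRwd : 0 ≤ Rwd)
    (hRb : 0 < Rb) (hRb1 : Rb ≤ 4 / 5)
    (hRbg : Rb ≤ 4 * min (ρd / 4) (3 * ρd * Real.sqrt θg / (16 * (2 * Rwd + ρd / 2))) / (5 * (2 * Rwd + 1))) :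
    ∃ Cpart Lmin : ℝ, 0 ≤ Cpart ∧ ∀ {Γ : ℝ} {p t : Fin N → EuclideanSpace ℝ (Fin 3)} {γ : Fin N → ℝ} {α : ℝ} {s₀ : Fin N → ℝ}
      {x : Fin N → ℝ → EuclideanSpace ℝ (Fin 3)}, 1 < Γ → Lmin ≤ Real.log Γ → IsLiaReference Γ Rb p t γ α s₀ x → (∀ k, ‖t k‖ = 1) →
      (∀ j k, j ≠ k → |inner ℝ (t j) (t k)| ≤ 1 - θg) →
      (∀ j k, j ≠ k → ∀ a b : ℝ, ρd ≤ ‖(p j + a • t j) - (p k + b • t k)‖) →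
      ∀ {θ₁ : ℝ}, 0 ≤ θ₁ →
      (∀ j k, j ≠ k → θ₁ ≤ min (Real.sqrt θg / 4) (θg * ρd / (16 * (‖(p j + s₀ j • t j) - (p k + s₀ k • t k)‖ + ρd)))) →
      (∀ k σ, ‖deriv (x k) σ - t k‖ ≤ Rb / 8) → Rb / 8 ≤ θ₁ → (∀ k, θp ≤ |γ k|) → (∀ k, |γ k| ≤ θp⁻¹) → |α| ≤ θp⁻¹ →
      (∀ k, ‖p k + s₀ k • t k‖ ≤ Rwd) → ∀ (j k : Fin N), k ≠ j → ∀ {τ : ℝ}, |τ| ≤ 3 * Rb * Real.sqrt Γ * Real.sqrt (Real.log Γ) →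
      ‖(Γ * γ k / (4 * Real.pi)) • ((∫ σ : ℝ, ((‖x j τ - x k σ‖ ^ 2 +
          Real.exp (-(1+Real.eulerMascheroniConstant-Real.log 2)) * (1:ℝ)) ^ (3 / 2 : ℝ))⁻¹ • cross (deriv (x k) σ) (x j τ - x k σ)) -
        ∫ σ : ℝ, ((‖x j τ - datumLine Γ p t s₀ k σ‖ ^ 2 +
          Real.exp (-(1+Real.eulerMascheroniConstant-Real.log 2)) * (1:ℝ)) ^ (3 / 2 : ℝ))⁻¹ • cross (t k) (x j τ - datumLine Γ p t s₀ k σ))‖ ≤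
        Cpart * (Real.sqrt Γ + |τ|) / Real.sqrt (Real.log Γ) := by
  -- universal and class constants
  set a₀ : ℝ := Real.exp (-(1+Real.eulerMascheroniConstant-Real.log 2)) * (1:ℝ) with ha₀
  have ha₀0 : 0 < a₀ := coreConst_pos
  set e : ℝ := Real.sqrt a₀ with he
  have he0 : 0 < e := Real.sqrt_pos.2 ha₀0
  have he2 : e ^ 2 = a₀ := Real.sq_sqrt ha₀0.le
  set B₀ : ℝ := N / (Real.pi * θp * ρd) with hB₀
  set Q₀ : ℝ := 1 / 2 + θp⁻¹ with hQ₀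
  set e₀ : ℝ := B₀ + Q₀ * Rwd with he₀
  set cst : ℝ := min (ρd / 4) (3 * ρd * Real.sqrt θg / (16 * (2 * Rwd + ρd / 2))) with hcst
  set Cs : ℝ := 2 * Rwd + 1 with hCs
  set κ : ℝ := 2 / θp ^ 2 with hκ
  set a₁ : ℝ := 51 * e₀ / cst + 104 * Q₀ with ha₁
  set p₀ : ℝ := 50 * e₀ * Cs ^ 2 / cst + 100 * Q₀ * Cs ^ 3 / cst + 2 * e₀ * Cs + 4 * Q₀ * Cs ^ 2 with hp₀
  have hB₀0 : 0 ≤ B₀ := by positivity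
  have hQ₀0 : 0 < Q₀ := by positivity
  have he₀0 : 0 ≤ e₀ := by positivity
  have hsθ : 0 < Real.sqrt θg := Real.sqrt_pos.2 hθg
  have hcst0 : 0 < cst := lt_min (by positivity) (by positivity)
  have hCs0 : 0 < Cs := by positivity
  have hκpos : 0 < κ := by positivity
  have ha₁0 : 0 ≤ a₁ := by positivity
  have hp₀0 : 0 ≤ p₀ := by positivity
  set Cpart : ℝ := κ * (4 * a₁ * Cs + 8 * a₁ * Rb + Real.pi * p₀ / cst) + 13 / (4 * θp) with hCpart
  refine ⟨Cpart, 4, by positivity, ?_⟩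
  intro Γ p t γ α s₀ x hΓ hLmin hx ht hgp hsep θ₁ hθ₁0 hθ₁A htilt hRbθ hγlo hγhi hα hq j k hkj τ hτ
  -- Γ-level quantities
  have hΓ0 : 0 < Γ := by linarith
  set G := Real.sqrt Γ with hG
  have hG0 : 0 < G := Real.sqrt_pos.2 hΓ0
  have hGG : G ^ 2 = Γ := Real.sq_sqrt hΓ0.le
  set L := Real.log Γ with hL
  have hL4 : 4 ≤ L := hLmin
  have hL0 : 0 < L := by linarith
  set sL := Real.sqrt L with hsL
  have hsL0 : 0 < sL := Real.sqrt_pos.2 hL0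
  have hsLL : sL ^ 2 = L := Real.sq_sqrt hL0.le
  have hsL1 : 1 ≤ sL := by rw [hsL, ← Real.sqrt_one]; exact Real.sqrt_le_sqrt (by linarith)
  have hsqrtΓL : Real.sqrt (Γ * L) = G * sL := Real.sqrt_mul hΓ0.le L
  set u := G + |τ| with hu
  have hu0 : 0 < u := by positivity
  have hGu : G ≤ u := by rw [hu]; linarith [abs_nonneg τ]
  have hτu : |τ| ≤ u := by rw [hu]; linarith
  -- β_k, c_k, b
  set β := liaCoeff Γ γ k with hβ
  have hγk : 0 < |γ k| := hθp.trans_le (hγlo k)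
  set b : ℝ := 8 * Real.pi / (θp * Γ * L) with hb
  have hb0 : 0 < b := by positivity
  have hβinv : |β⁻¹| ≤ b := by
    rw [hβ, abs_inv]; unfold liaCoeff
    rw [hb, abs_div, abs_mul, abs_mul, abs_of_pos hΓ0, ← hL, abs_of_pos hL0, abs_of_pos (by positivity : (0:ℝ) < 8 * Real.pi), inv_div]
    refine div_le_div_of_nonneg_left (by positivity) (by positivity) ?_
    calc θp * Γ * L = θp * (Γ * L) := by ring
      _ ≤ |γ k| * (Γ * L) := mul_le_mul_of_nonneg_right (hγlo k) (by positivity)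
      _ = Γ * |γ k| * L := by ring
  set cΓ : ℝ := Γ / (4 * Real.pi * θp) with hcΓ
  have h4π : (0:ℝ) < 4 * Real.pi := by positivity
  have hγθ : ∀ k, |γ k| * θp ≤ 1 := fun k => by rw [← le_div_iff₀ hθp, one_div]; exact hγhi k
  have hcabs : |Γ * γ k / (4 * Real.pi)| ≤ cΓ := by
    rw [hcΓ, abs_div, abs_mul, abs_of_pos hΓ0, abs_of_pos h4π, div_le_div_iff₀ h4π (by positivity)]
    calc Γ * |γ k| * (4 * Real.pi * θp) = (|γ k| * θp) * (4 * Real.pi * Γ) := by ring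
      _ ≤ 1 * (4 * Real.pi * Γ) := mul_le_mul_of_nonneg_right (hγθ k) (by positivity)
      _ = Γ * (4 * Real.pi) := by ring
  have hcΓ0 : 0 ≤ cΓ := by positivity
  have hcb : cΓ * b = κ / L := by rw [hcΓ, hb, hκ]; field_simp; ring
  -- the partner's curvature envelope (filament k)
  set d : ℝ := ρd / 2 * G with hd
  have hd0 : 0 < d := by positivity
  have hfark : ∀ σ, ∀ m, m ≠ k → d ^ 2 ≤ ‖x k σ - waistPt Γ p t s₀ m‖ ^ 2 - (inner ℝ (x k σ - waistPt Γ p t s₀ m) (t m)) ^ 2 :=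
    fun σ => hx.dist_partner_ge_of_tilt ht hθg hθg1 hgp hρ hsep k hθ₁0 (fun m hm => hθ₁A k m hm.symm) (fun σ => (htilt k σ).trans hRbθ) σ
  set ε₀ := b * e₀ * G with hε₀
  set ε₁ := b * Q₀ with hε₁
  have hε₀0 : 0 ≤ ε₀ := by positivity
  have hε₁0 : 0 ≤ ε₁ := by positivity
  have hQ : 1 / 2 + |α| ≤ Q₀ := by rw [hQ₀]; linarith
  have hwk : ‖waistPt Γ p t s₀ k‖ ≤ Rwd * G := by
    rw [waistPt_eq, norm_smul, Real.norm_of_nonneg hG0.le, mul_comm]; exact mul_le_mul_of_nonneg_right (hq k) hG0.le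
  have hBdk : (∑ m ∈ Finset.univ.erase k, |Γ*γ m/(4*Real.pi)| * (2 / d)) ≤ B₀ * G := by
    have hterm : ∀ m ∈ Finset.univ.erase k, |Γ*γ m/(4*Real.pi)| * (2 / d) ≤ G / (Real.pi * θp * ρd) := by
      intro m _
      rw [hd, abs_div, abs_mul, abs_of_pos hΓ0, abs_of_pos h4π, ← hGG]
      have e1 : G ^ 2 * |γ m| / (4 * Real.pi) * (2 / (ρd / 2 * G)) = (|γ m| * θp) * (G / (Real.pi * θp * ρd)) := by
        first | (field_simp; ring) | field_simp
      rw [e1]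
      calc (|γ m| * θp) * (G / (Real.pi * θp * ρd)) ≤ 1 * (G / (Real.pi * θp * ρd)) :=
            mul_le_mul_of_nonneg_right (hγθ m) (by positivity)
        _ = G / (Real.pi * θp * ρd) := one_mul _
    calc _ ≤ ∑ m ∈ Finset.univ.erase k, G / (Real.pi * θp * ρd) := Finset.sum_le_sum hterm
      _ = (Finset.univ.erase k).card * (G / (Real.pi * θp * ρd)) := by rw [Finset.sum_const, nsmul_eq_mul]
      _ ≤ N * (G / (Real.pi * θp * ρd)) := by
          refine mul_le_mul_of_nonneg_right ?_ (by positivity)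
          have : (Finset.univ.erase k).card ≤ N := by
            rw [Finset.card_erase_of_mem (Finset.mem_univ k), Finset.card_univ, Fintype.card_fin]; exact Nat.sub_le N 1
          exact_mod_cast this
      _ = B₀ * G := by rw [hB₀]; ring
  have henv : ∀ σ, ‖deriv (deriv (x k)) σ‖ ≤ ε₀ + ε₁ * |σ| := by
    intro σ
    have h := hx.curvature_envelope ht k σ hd0 (hfark σ)
    have hm : (1/2 + |α|) * (‖waistPt Γ p t s₀ k‖ + |σ|) ≤ Q₀ * (Rwd * G + |σ|) :=
      mul_le_mul hQ (add_le_add hwk (le_refl |σ|)) (by positivity) hQ₀0.le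
    have h2 : (∑ m ∈ Finset.univ.erase k, |Γ*γ m/(4*Real.pi)| * (2 / d)) + (1/2 + |α|) * (‖waistPt Γ p t s₀ k‖ + |σ|) ≤
        e₀ * G + Q₀ * |σ| := by
      calc _ ≤ B₀ * G + Q₀ * (Rwd * G + |σ|) := add_le_add hBdk hm
        _ = e₀ * G + Q₀ * |σ| := by rw [he₀]; ring
    calc ‖deriv (deriv (x k)) σ‖ ≤ |β⁻¹| * ((∑ m ∈ Finset.univ.erase k, |Γ*γ m/(4*Real.pi)| * (2 / d)) +
          (1/2 + |α|) * (‖waistPt Γ p t s₀ k‖ + |σ|)) := h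
      _ ≤ b * (e₀ * G + Q₀ * |σ|) := mul_le_mul hβinv h2 (by positivity) hb0.le
      _ = ε₀ + ε₁ * |σ| := by rw [hε₀, hε₁]; ring
  -- the foot geometry at y = x_j τ
  set y := x j τ with hy
  set s : ℝ := inner ℝ (y - waistPt Γ p t s₀ k) (t k) with hs
  set Dk : ℝ := ‖y - waistPt Γ p t s₀ k‖ ^ 2 - s ^ 2 with hDk
  have hqjk : ‖(p j + s₀ j • t j) - (p k + s₀ k • t k)‖ ≤ 2 * Rwd := by
    calc ‖(p j + s₀ j • t j) - (p k + s₀ k • t k)‖ ≤ ‖p j + s₀ j • t j‖ + ‖p k + s₀ k • t k‖ := norm_sub_le _ _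
      _ ≤ 2 * Rwd := by linarith [hq j, hq k]
  obtain ⟨hsle, hVle⟩ := hx.abs_foot_le ht j k τ
  have hsu : |s| ≤ Cs * u := by
    have hVle' : ‖x j τ - waistPt Γ p t s₀ k‖ ≤ G * ‖(p j + s₀ j • t j) - (p k + s₀ k • t k)‖ + |τ| := hVle
    have hsle' : |s| ≤ ‖x j τ - waistPt Γ p t s₀ k‖ := hsle
    have h1 : G * ‖(p j + s₀ j • t j) - (p k + s₀ k • t k)‖ ≤ G * (2 * Rwd) := mul_le_mul_of_nonneg_left hqjk hG0.le
    have h2 : 0 ≤ (2 * Rwd) * |τ| := by positivity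
    have heq : Cs * u = G * (2 * Rwd) + |τ| + ((2 * Rwd) * |τ| + G) := by rw [hCs, hu]; ring
    rw [heq]
    linarith only [hVle', hsle', h1, h2, hG0.le]
  have hDk0 : (ρd / 2 * G) ^ 2 ≤ Dk := by
    have h := hx.dist_partner_ge_of_tilt ht hθg hθg1 hgp hρ hsep j hθ₁0 (fun m hm => hθ₁A j m hm.symm) (fun σ => (htilt j σ).trans hRbθ) τ k hkj
    rw [hDk, hs, hy]; exact h
  have hDkpos : 0 < Dk := lt_of_lt_of_le (by positivity) hDk0
  set atrue := Real.sqrt Dk with hatrue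
  have hat1 : ρd / 2 * G ≤ atrue := by rw [hatrue]; exact Real.le_sqrt_of_sq_le hDk0
  have hθ₁s : θ₁ ≤ Real.sqrt θg / 4 := by
    rcases Nat.lt_or_ge 1 N with hN | hN
    · exact (hθ₁A j k hkj.symm).trans (min_le_left _ _)
    · exfalso
      have : Fintype.card (Fin N) ≤ 1 := by rw [Fintype.card_fin]; exact hN
      exact hkj (Fintype.card_le_one_iff.1 this k j)
  have hat2 : (Real.sqrt θg - θ₁) * |τ| - G * ‖(p j + s₀ j • t j) - (p k + s₀ k • t k)‖ ≤ atrue := by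
    have h := hx.dist_partner_linear ht hθg hθg1 j k (hgp j k hkj.symm) (fun σ => (htilt j σ).trans hRbθ) τ
    rw [hatrue, hDk, hs, hy]; exact h
  have hat3 : min (ρd / 4) (3 * ρd * Real.sqrt θg / (16 * (‖(p j + s₀ j • t j) - (p k + s₀ k • t k)‖ + ρd / 2))) * (G + |τ|) ≤ atrue :=
    dist_partner_ge_linear hρ hθg hG0.le (abs_nonneg τ) (norm_nonneg _) hθ₁s hat1 hat2
  have hcst_le : cst ≤ min (ρd / 4) (3 * ρd * Real.sqrt θg / (16 * (‖(p j + s₀ j • t j) - (p k + s₀ k • t k)‖ + ρd / 2))) := by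
    rw [hcst]
    refine le_min (min_le_left _ _) ((min_le_right _ _).trans ?_)
    exact div_le_div_of_nonneg_left (by positivity) (by positivity) (by nlinarith [hqjk])
  set a : ℝ := cst * u with ha
  have ha0 : 0 < a := by positivity
  have haat : a ≤ atrue := by rw [ha, hu]; exact (mul_le_mul_of_nonneg_right hcst_le (by positivity)).trans hat3
  have hay : a ^ 2 ≤ ‖y - waistPt Γ p t s₀ k‖ ^ 2 - (inner ℝ (y - waistPt Γ p t s₀ k) (t k)) ^ 2 := by
    rw [← hs, ← hDk, ← Real.sq_sqrt hDkpos.le, ← hatrue]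
    exact pow_le_pow_left₀ ha0.le haat 2
  have hθs : 10 * (Rb / 8) * |inner ℝ (y - waistPt Γ p t s₀ k) (t k)| ≤ a := by
    rw [← hs, ha]
    have h1 : 10 * (Rb / 8) * |s| ≤ 10 * (Rb / 8) * (Cs * u) := mul_le_mul_of_nonneg_left hsu (by positivity)
    have h2 : 10 * (Rb / 8) * Cs ≤ cst := by
      have h := hRbg
      rw [le_div_iff₀ (by positivity)] at h
      linarith only [h]
    calc 10 * (Rb / 8) * |s| ≤ 10 * (Rb / 8) * (Cs * u) := h1
      _ = (10 * (Rb / 8) * Cs) * u := by ring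
      _ ≤ cst * u := mul_le_mul_of_nonneg_right h2 hu0.le
  -- brick P2 at y with L₀ = 4ℓ
  set L₀ : ℝ := 4 * (Rb * G * sL) with hL₀
  have hL₀0 : 0 < L₀ := by positivity
  have hP := hx.partnerStrand_sub_le ht k hε₀0 hε₁0 henv (by positivity : (0:ℝ) ≤ Rb / 8) (by linarith : Rb / 8 ≤ 1 / 10)
    (htilt k) he0.ne' y ha0 hL₀0 hay hθs
  simp only [he2, ← hs] at hP
  -- bound the three pieces
  rw [norm_smul, Real.norm_eq_abs]
  refine (mul_le_mul hcabs hP (norm_nonneg _) hcΓ0).trans ?_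
  have hεa : ε₀ / a ≤ b * e₀ / cst := by
    rw [hε₀, ha, div_le_div_iff₀ ha0 hcst0]
    have h1 : G * cst ≤ u * cst := mul_le_mul_of_nonneg_right hGu hcst0.le
    calc b * e₀ * G * cst = (b * e₀) * (G * cst) := by ring
      _ ≤ (b * e₀) * (u * cst) := mul_le_mul_of_nonneg_left h1 (by positivity)
      _ = b * e₀ * (cst * u) := by ring
  have hA0 : 50 * ε₀ / a + 100 * ε₁ + ε₀ / a + 4 * ε₁ ≤ b * a₁ := by
    have : 50 * ε₀ / a + 100 * ε₁ + ε₀ / a + 4 * ε₁ = 51 * (ε₀ / a) + 104 * ε₁ := by ring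
    rw [this, ha₁, hε₁]
    have : 51 * (ε₀ / a) ≤ 51 * (b * e₀ / cst) := by linarith
    have heq : b * (51 * e₀ / cst + 104 * Q₀) = 51 * (b * e₀ / cst) + 104 * (b * Q₀) := by ring
    rw [heq]; linarith
  have hLk : 2 * |s| + L₀ ≤ 2 * Cs * u + 4 * Rb * G * sL := by rw [hL₀]; linarith
  -- T1
  have T1 : cΓ * (2 * (2 * |s| + L₀) * (50 * ε₀ / a + 100 * ε₁ + ε₀ / a + 4 * ε₁)) ≤ κ * (4 * a₁ * Cs + 8 * a₁ * Rb) * (u / sL) := by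
    have h1 : cΓ * (2 * (2 * |s| + L₀) * (50 * ε₀ / a + 100 * ε₁ + ε₀ / a + 4 * ε₁)) ≤ cΓ * (2 * (2 * Cs * u + 4 * Rb * G * sL) * (b * a₁)) := by
      have hin0 : 0 ≤ 50 * ε₀ / a + 100 * ε₁ + ε₀ / a + 4 * ε₁ := by positivity
      gcongr
    refine h1.trans ?_
    have heq : cΓ * (2 * (2 * Cs * u + 4 * Rb * G * sL) * (b * a₁)) = κ * (4 * a₁ * Cs) * (u / sL ^ 2) + κ * (8 * a₁ * Rb) * (G / sL) := by
      rw [show cΓ * (2 * (2 * Cs * u + 4 * Rb * G * sL) * (b * a₁)) = (cΓ * b) * (4 * a₁ * Cs) * u + (cΓ * b) * (8 * a₁ * Rb) * G * sL by ring,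
        hcb, ← hsLL]
      first | (field_simp; ring) | field_simp
    rw [heq]
    obtain ⟨_, rus, rGs⟩ := ratio_bounds hG0.le hGu hsL1
    have := add_le_add (mul_le_mul_of_nonneg_left rus (by positivity : (0:ℝ) ≤ κ * (4 * a₁ * Cs)))
      (mul_le_mul_of_nonneg_left rGs (by positivity : (0:ℝ) ≤ κ * (8 * a₁ * Rb)))
    refine this.trans (le_of_eq ?_); ring
  -- T2
  have T2 : cΓ * ((50 * ε₀ * s ^ 2 / a + 100 * ε₁ * |s| ^ 3 / a + 2 * ε₀ * |s| + 4 * ε₁ * s ^ 2) * (Real.pi / a)) ≤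
      κ * (Real.pi * p₀ / cst) * (u / sL) := by
    have hs2 : s ^ 2 ≤ Cs ^ 2 * u ^ 2 := by rw [← sq_abs s, ← mul_pow]; exact pow_le_pow_left₀ (abs_nonneg s) hsu 2
    have hs3 : |s| ^ 3 ≤ Cs ^ 3 * u ^ 3 := by rw [← mul_pow]; exact pow_le_pow_left₀ (abs_nonneg s) hsu 3
    have hA1 : 50 * ε₀ * s ^ 2 / a + 100 * ε₁ * |s| ^ 3 / a + 2 * ε₀ * |s| + 4 * ε₁ * s ^ 2 ≤ b * p₀ * u ^ 2 := by
      have t1 : 50 * ε₀ * s ^ 2 / a ≤ 50 * (b * e₀ / cst) * (Cs ^ 2 * u ^ 2) := by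
        rw [show 50 * ε₀ * s ^ 2 / a = 50 * (ε₀ / a) * s ^ 2 by ring]
        exact mul_le_mul (mul_le_mul_of_nonneg_left hεa (by norm_num)) hs2 (sq_nonneg s) (by positivity)
      have t2 : 100 * ε₁ * |s| ^ 3 / a ≤ 100 * (b * Q₀) * (Cs ^ 3 * u ^ 2 / cst) := by
        rw [hε₁, ha, show 100 * (b * Q₀) * |s| ^ 3 / (cst * u) = 100 * (b * Q₀) * (|s| ^ 3 / (cst * u)) by ring]
        refine mul_le_mul_of_nonneg_left ?_ (by positivity)
        rw [div_le_div_iff₀ (by positivity) hcst0]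
        calc |s| ^ 3 * cst ≤ Cs ^ 3 * u ^ 3 * cst := mul_le_mul_of_nonneg_right hs3 hcst0.le
          _ = Cs ^ 3 * u ^ 2 * (cst * u) := by ring
      have t3 : 2 * ε₀ * |s| ≤ 2 * (b * e₀) * (Cs * u ^ 2) := by
        rw [hε₀]
        have h1 : 2 * (b * e₀ * G) * |s| ≤ 2 * (b * e₀ * G) * (Cs * u) := mul_le_mul_of_nonneg_left hsu (by positivity)
        have h2 : 2 * (b * e₀ * G) * (Cs * u) ≤ 2 * (b * e₀ * u) * (Cs * u) := by gcongr
        calc 2 * (b * e₀ * G) * |s| ≤ 2 * (b * e₀ * u) * (Cs * u) := h1.trans h2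
          _ = 2 * (b * e₀) * (Cs * u ^ 2) := by ring
      have t4 : 4 * ε₁ * s ^ 2 ≤ 4 * (b * Q₀) * (Cs ^ 2 * u ^ 2) := by rw [hε₁]; gcongr
      have heq : b * p₀ * u ^ 2 = 50 * (b * e₀ / cst) * (Cs ^ 2 * u ^ 2) + 100 * (b * Q₀) * (Cs ^ 3 * u ^ 2 / cst) +
          2 * (b * e₀) * (Cs * u ^ 2) + 4 * (b * Q₀) * (Cs ^ 2 * u ^ 2) := by rw [hp₀]; first | (field_simp; ring) | field_simp
      rw [heq]; linarith
    have hπa : Real.pi / a ≤ Real.pi / (cst * u) := le_of_eq (by rw [ha])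
    calc cΓ * ((50 * ε₀ * s ^ 2 / a + 100 * ε₁ * |s| ^ 3 / a + 2 * ε₀ * |s| + 4 * ε₁ * s ^ 2) * (Real.pi / a))
        ≤ cΓ * ((b * p₀ * u ^ 2) * (Real.pi / (cst * u))) := by
          refine mul_le_mul_of_nonneg_left (mul_le_mul hA1 hπa (by positivity) (by positivity)) hcΓ0
      _ = κ * (Real.pi * p₀ / cst) * (u / sL ^ 2) := by
          rw [show cΓ * ((b * p₀ * u ^ 2) * (Real.pi / (cst * u))) = (cΓ * b) * p₀ * u ^ 2 * Real.pi / (cst * u) by ring, hcb, ← hsLL]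
          first | (field_simp; ring) | field_simp
      _ ≤ κ * (Real.pi * p₀ / cst) * (u / sL) := mul_le_mul_of_nonneg_left (ratio_bounds hG0.le hGu hsL1).2.1 (by positivity)
  -- T3
  have T3 : cΓ * (416 * (Rb / 8) * (Real.pi / (2 * |s| + L₀))) ≤ 13 / (4 * θp) * (u / sL) := by
    have h1 : Real.pi / (2 * |s| + L₀) ≤ Real.pi / L₀ := div_le_div_of_nonneg_left (by positivity) hL₀0 (by linarith [abs_nonneg s])
    calc cΓ * (416 * (Rb / 8) * (Real.pi / (2 * |s| + L₀))) ≤ cΓ * (416 * (Rb / 8) * (Real.pi / L₀)) := by gcongr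
      _ = 13 / (4 * θp) * (G / sL) := by rw [hcΓ, hL₀, ← hGG]; first | (field_simp; ring) | field_simp
      _ ≤ 13 / (4 * θp) * (u / sL) := mul_le_mul_of_nonneg_left (ratio_bounds hG0.le hGu hsL1).2.2 (by positivity)
  have htot : cΓ * (2 * (2 * |s| + L₀) * (50 * ε₀ / a + 100 * ε₁ + ε₀ / a + 4 * ε₁) +
      (50 * ε₀ * s ^ 2 / a + 100 * ε₁ * |s| ^ 3 / a + 2 * ε₀ * |s| + 4 * ε₁ * s ^ 2) * (Real.pi / a) + 416 * (Rb / 8) * (Real.pi / (2 * |s| + L₀))) =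
      cΓ * (2 * (2 * |s| + L₀) * (50 * ε₀ / a + 100 * ε₁ + ε₀ / a + 4 * ε₁)) +
      cΓ * ((50 * ε₀ * s ^ 2 / a + 100 * ε₁ * |s| ^ 3 / a + 2 * ε₀ * |s| + 4 * ε₁ * s ^ 2) * (Real.pi / a)) +
      cΓ * (416 * (Rb / 8) * (Real.pi / (2 * |s| + L₀))) := by ring
  rw [htot]
  have hfinal : κ * (4 * a₁ * Cs + 8 * a₁ * Rb) * (u / sL) + κ * (Real.pi * p₀ / cst) * (u / sL) + 13 / (4 * θp) * (u / sL) = Cpart * u / sL := by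
    rw [hCpart]; ring
  linarith only [T1, T2, T3, hfinal.le, hfinal.ge]

end Summit.NavierStokesRegularity.NavierStokesRegularity.Theorems.SkeletonJ1RFrame

end
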